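import Literature.AlgebraicGeometry.Frobenioids.UnitTrivialisationFunctoriality
import Literature.AlgebraicGeometry.Frobenioids.EquivalenceUnitsDivSlim
import Literature.AlgebraicGeometry.Frobenioids.IsometricPreSteps
import Mathlib.CategoryTheory.ObjectProperty.Equivalence
import HarnessLib

/-!
# Frobenioids I, Corollary 4.11 (i) — INSTANCE for Frobenioids `C_i → F_{Φ_i}`, modulo the rigidity of
# `C₁^istr → C₂^un-tr`

Mochizuki, *The geometry of Frobenioids I: the general theory*, Kyushu J. Math. **62** (2008)
293–400, kurims text proof of Cor. 4.11 (i) pp. 92–93: "it suffices to show that `Ψ` preserves '`O^×(-)`'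
… since `Ψ` preserves pull-back morphisms [cf. Theorem 3.4, (iii)] and Div-identity automorphisms
[cf. Theorem 4.2, (i) …], we thus conclude that `Ψ` preserves '`O^×(-)`', as desired"
[cite: MochizukiFrdI2008, Cor. 4.11 (i) p.92].

PROOF-ONLY. Assembles, for Frobenioids over Div-slim bases, the square part of the typed Cor. 4.11 (i)
(`PreFrobenioidData.Cor411i`, seat abc-iut-L1-t3) for THE restriction `Ψ^istr : C₁^istr ⥲ C₂^istr` of `Ψ` to
the isotropic objects, from:
* "`Ψ`, `Ψ⁻¹` preserve `O^×(-)`" — `PreFrobenioid.mapIso_mem_unitsSubgroup_of_isDivSlim`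
  (`EquivalenceUnitsDivSlim.lean`, seat abc-iut-L1-t10: the Div-slimness argument of pp. 92–93), whose
  inputs are the typed conclusions of Thm. 3.4 (iii) (pull-back morphisms) and Thm. 4.2 (i) (Div-identity
  endomorphisms) for `Ψ` and `Ψ⁻¹`;
* the functoriality of `C^un-tr` (`UnitTrivialisationFunctoriality.lean`: `cor411i_of_units`);
* "`Ψ` preserves isotropic objects" (Thm. 3.4 (i)), to restrict `Ψ` to `C_i^istr`
  (`Equivalence.congrFullSubcategory`).
The rigidity of the composites with `C₂^un-tr` (print: every automorphism induced by an automorphism of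
`C_i → C_i^un-tr` is a Div-identity, hence, by Div-slimness, a base-identity automorphism, hence trivial in
`C^un-tr`, p. 93) remains an input.

* `cor411i_restrict_of_rigid`: the statement.

No statement of the paper is strengthened; nothing here is specific to the abc programme.
-/

namespace Literature.AlgebraicGeometry.Frobenioids

open CategoryTheory Opposite

universe w v v' u u'

namespace PreFrobenioid

variable {D₁ : Type u} [Category.{v} D₁] {Φ₁ : D₁ᵒᵖ ⥤ CommMonCat.{w}}
  {C₁ : Type u'} [Category.{v'} C₁] (F₁ : C₁ ⥤ ElemFrobenioid Φ₁)
  {D₂ : Type u} [Category.{v} D₂] {Φ₂ : D₂ᵒᵖ ⥤ CommMonCat.{w}}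
  {C₂ : Type u'} [Category.{v'} C₂] (F₂ : C₂ ⥤ ElemFrobenioid Φ₂)
  (Ψ : C₁ ≌ C₂)

/-- **Corollary 4.11 (i) for Frobenioids over Div-slim bases, modulo the rigidity of `C₁^istr → C₂^un-tr`**
(FrdI pp. 92–93): if `Ψ` preserves isotropic objects (Thm. 3.4 (i)), `Ψ`, `Ψ⁻¹` preserve pull-back
morphisms (Thm. 3.4 (iii)) and Div-identity endomorphisms (Thm. 4.2 (i)), then — `Ψ`, `Ψ⁻¹` preserving
`O^×(-)` by the Div-slimness argument — the restriction `Ψ^istr` of `Ψ` to the isotropic objects induces a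
`1`-unique equivalence `Ψ^un-tr : C₁^un-tr ⥲ C₂^un-tr` `1`-commuting with the projections, and the typed
Cor. 4.11 (i) holds for `Ψ^istr` as soon as the composite `C₁^istr → C₂^istr → C₂^un-tr` is rigid.
[cite: MochizukiFrdI2008, Cor. 4.11 (i) p.91] -/
theorem cor411i_restrict_of_rigid (hF₁ : IsFrobenioid F₁) (hF₂ : IsFrobenioid F₂)
    (hiso : ∀ A : C₁, (PreFrobenioidData.ofFunctor Φ₂ F₂).IsIsotropic (Ψ.functor.obj A) ↔
      (PreFrobenioidData.ofFunctor Φ₁ F₁).IsIsotropic A)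
    (hds₁ : (PreFrobenioidData.ofFunctor Φ₁ F₁).IsDivSlim) (hds₂ : (PreFrobenioidData.ofFunctor Φ₂ F₂).IsDivSlim)
    (hpb : PreFrobenioidData.PreservesMor Ψ.functor (PreFrobenioidData.ofFunctor Φ₁ F₁).IsPullbackMorphism
      (PreFrobenioidData.ofFunctor Φ₂ F₂).IsPullbackMorphism)
    (hpb' : PreFrobenioidData.PreservesMor Ψ.inverse (PreFrobenioidData.ofFunctor Φ₂ F₂).IsPullbackMorphism
      (PreFrobenioidData.ofFunctor Φ₁ F₁).IsPullbackMorphism)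
    (hdi : ∀ (A : C₁) (φ : A ⟶ A), (PreFrobenioidData.ofFunctor Φ₁ F₁).IsDivIdentity φ →
      (PreFrobenioidData.ofFunctor Φ₂ F₂).IsDivIdentity (Ψ.functor.map φ))
    (hdi' : ∀ (B : C₂) (φ : B ⟶ B), (PreFrobenioidData.ofFunctor Φ₂ F₂).IsDivIdentity φ →
      (PreFrobenioidData.ofFunctor Φ₁ F₁).IsDivIdentity (Ψ.inverse.map φ)) :
    ∃ Ψistr : (PreFrobenioidData.ofFunctor Φ₁ F₁).Istr ≌ (PreFrobenioidData.ofFunctor Φ₂ F₂).Istr,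
      Ψistr.functor ⋙ (PreFrobenioidData.ofFunctor Φ₂ F₂).istrι =
          (PreFrobenioidData.ofFunctor Φ₁ F₁).istrι ⋙ Ψ.functor ∧
        (∃ Ψuntr : (PreFrobenioidData.ofFunctor Φ₁ F₁).Untr ⥤ (PreFrobenioidData.ofFunctor Φ₂ F₂).Untr,
          PreFrobenioidData.OneUniqueSquare Ψistr.functor (PreFrobenioidData.ofFunctor Φ₁ F₁).toUntr
            (PreFrobenioidData.ofFunctor Φ₂ F₂).toUntr Ψuntr) ∧
        (IsRigidFunctor (Ψistr.functor ⋙ (PreFrobenioidData.ofFunctor Φ₂ F₂).toUntr) →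
          (PreFrobenioidData.ofFunctor Φ₁ F₁).Cor411i (PreFrobenioidData.ofFunctor Φ₂ F₂) Ψ Ψistr.functor) := by
  -- `Ψ^istr : C₁^istr ≌ C₂^istr`, the restriction of `Ψ` to the isotropic objects
  haveI : (PreFrobenioidData.ofFunctor Φ₂ F₂).isotropicObjects.IsClosedUnderIsomorphisms :=
    ⟨fun e hX => (PreFrobenioidData.ofFunctor_isIsotropic F₂ _).2
      (IsIsotropic.of_iso hF₂.isPreFrobenioid e.symm ((PreFrobenioidData.ofFunctor_isIsotropic F₂ _).1 hX))⟩
  have hinv : (PreFrobenioidData.ofFunctor Φ₂ F₂).isotropicObjects.inverseImage Ψ.functor =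
      (PreFrobenioidData.ofFunctor Φ₁ F₁).isotropicObjects := by
    funext X
    exact propext (hiso X)
  let Ψi : (PreFrobenioidData.ofFunctor Φ₁ F₁).Istr ≌ (PreFrobenioidData.ofFunctor Φ₂ F₂).Istr :=
    Ψ.congrFullSubcategory hinv
  -- `Ψ^istr`, `(Ψ^istr)⁻¹` preserve `O^×(-)` (the Div-slimness argument), hence `≈^{O^×}`
  have hG := PreFrobenioidData.unitEquiv_map_of_units _ _ Ψi.functor fun X δ hδ =>
    ⟨Ψ.functor.mapIso δ, mapIso_mem_unitsSubgroup_of_isDivSlim F₁ F₂ Ψ hF₂ hds₂ hpb' hdi δ hδ, rfl⟩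
  have hG' := PreFrobenioidData.unitEquiv_map_of_units _ _ Ψi.inverse fun X δ hδ =>
    ⟨Ψ.inverse.mapIso δ, mapIso_mem_unitsSubgroup_of_isDivSlim F₂ F₁ Ψ.symm hF₁ hds₁ hpb hdi' δ hδ, rfl⟩
  refine ⟨Ψi, rfl, PreFrobenioidData.exists_untr_oneUniqueSquare _ _ Ψi hG hG', fun hrig => ?_⟩
  exact PreFrobenioidData.cor411i_of_units _ _ Ψ Ψi hG hG' hrig

end PreFrobenioid

end Literature.AlgebraicGeometry.Frobenioids
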